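import Literature.GroupTheory.CombinatorialGroupTheory.PuncturedSurfaceGroupNodeLoopBasis
import Literature.GroupTheory.CombinatorialGroupTheory.PuncturedSurfaceGroupCusps
import Mathlib.GroupTheory.QuotientGroup.Basic
import Mathlib.Algebra.Group.Subgroup.Pointwise
import Mathlib.GroupTheory.GroupAction.ConjAct
import Mathlib.GroupTheory.Index
import HarnessLib

/-!
# The vertex twist: level characters of `Γ_{g,r}` that see ONE level vertex, for vertex groups that are not free factors

Topic `Literature/GroupTheory/CombinatorialGroupTheory`; PROOF-ONLY (0 definitions).  Mochizuki, [CombGC], PROOF of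
Prop. 1.2, p. 9 [cite: MochizukiCombGC2007, Prop 1.2 proof p.9]: "if `v₁ ≠ v₂` …, then there exists a finite étale …
covering `G' → G` whose restriction to the anabelioid `G_{v₂}` is trivial …, but whose restriction to the anabelioid
`G_{v₁}` is nontrivial.  But … by gluing together appropriate finite étale coverings of the anabelioids `G_v`, `G_e`,
one may construct a finite étale covering `G' → G` with the desired properties."  The DISCRETE half of this gluing for `Γ = Γ_{g,r} = ⟨a_i, b_i, c_j ∣ ∏[a_i,b_i]·∏c_j⟩` and a VERTEX
GROUP `H ≤ Γ` that need NOT be the closure of a free factor (an amalgam vertex, the HNN vertex of the loops).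

THE TWIST.  Fix a set `T` of "twisted" letters — whole handles (`a_i ∈ T ↔ b_i ∈ T`) and either all or none of the
cusps — a character `Φ : Γ → M` (`M` abelian) and a vertex group `H = ⟨S⟩` generated by twisted letters and by words
in the UNTWISTED letters killed by `Φ` (the node branches seen from the vertex), containing every twisted letter.  For
a level `N ⊴ Γ` and `f ∈ Γ` let `O ⊆ Γ/N` be the `H`-orbit of `π(f⁻¹)`; a twisted letter `s` acts on `(Γ/N) × M` by
`(q, m) ↦ (s·q, m·Φ(s)^{[q ∈ O]})`, an untwisted one by `(q, m) ↦ (s·q, m)`.  The ONE surface relator acts trivially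
(`PresentedGroup.toGroup`: twisted commutator blocks give `Φ([a_i,b_i])^{[·]} = 1`, the cusp block `Φ(∏ c_j)^{[q ∈ O]}
= 1` as `∏ c_j = (∏[a_i,b_i])⁻¹`) — no free basis, Bass–Serre tree or HNN/amalgam normal form.  Then `N` acts
fibrewise through `χ : N → M` with `χ(g h g⁻¹) = Φ(h)` if `f⁻¹ g ∈ H·N`, `= 1` if not (`h ∈ H`, `g h g⁻¹ ∈ N`),
killing the level conjugates of the untwisted subgroup (`exists_levelCharacter_vertexTwist`; abc-iut-f-166's
`FreeProductFibredTwist` evaluation formula without the coproduct); `exists_normal_separating_vertexTwist` is the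
separating level `U = Ker χ ⊴ N`, `[N : U] ∣ |M|` (shape of the discrete suppliers of abc-iut-w5-d047's
`IsProSigmaCompletion.exists_open_unrSeparating_same/_cross`).

SCOPE / DELTA (v2, doc-only).  For FREE `Γ` (a cusp somewhere) the same construction with a free basis is
abc-iut-f-164's cut-off character twist `FreeBasisCutoffCharacterTwist.lean` → `PSCSeparatingCoveringsCutoffVertex.lean`
→ `PSCSeparatingCoveringsTwoComponentUnmarked.lean` (two components, `C₁` unmarked, `r ≥ 1`), and for `Δ_irr` with
cusps abc-iut-w5-d174's `FreeGroupCyclicKernelBasis.lean` → `PSCIrreducibleNodalCommTerminal.lean` (`Γ_{g,r+1}`); those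
results are NOT restated by the consumers of this file, which works for EVERY `r` including `r = 0` — the closed
surface group `Γ_{g,0}` (no free basis) — and is consumed only at the cusp-free carriers (two-component data with both
components unmarked; the unpointed irreducible nodal datum).  abc-iut-w5-d183 (gen 5).  Nothing on [IUTchIII] Cor. 3.12.
-/

namespace Literature.GroupTheory.CombinatorialGroupTheory

namespace PuncturedSurfaceGroup

open scoped Pointwise

variable {g r : ℕ}

/-- In an abelian group a commutator is trivial. [folklore] -/
private theorem map_comm_eq_one {Γ M : Type*} [Group Γ] [CommGroup M] (Φ : Γ →* M) (x y : Γ) :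
    Φ (x * y * x⁻¹ * y⁻¹) = 1 := by
  rw [map_mul, map_mul, map_mul, map_inv, map_inv, mul_right_comm (Φ x), mul_inv_cancel, one_mul,
    mul_inv_cancel]

/-- Any character of `Γ_{g,r}` kills the cusp product `c_0 ⋯ c_{r−1} = (∏[a_i,b_i])⁻¹`.
[cite: MochizukiSemiAnbd2006, Ex. 2.10 p.31] -/
theorem map_cusp_prod_eq_one {M : Type*} [CommGroup M] (Φ : PuncturedSurfaceGroup g r →* M) :
    Φ ((List.finRange r).map fun j : Fin r => c (g := g) j).prod = 1 := by
  have h := congrArg Φ (comm_prod_mul_cusp_prod_eq_one (g := g) (r := r))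
  rw [map_mul, map_one, map_list_prod, List.map_map] at h
  have h1 : ((List.finRange g).map (Φ ∘ fun i : Fin g => a (r := r) i * b i * (a i)⁻¹ * (b i)⁻¹)).prod
      = 1 := List.prod_eq_one fun y hy => by
    obtain ⟨i, -, rfl⟩ := List.mem_map.mp hy
    exact map_comm_eq_one Φ _ _
  rwa [h1, one_mul] at h

/-- **The vertex twist** ([CombGC] Prop. 1.2 proof p. 9, "gluing together appropriate finite étale coverings of
the anabelioids `G_v`, `G_e`", discrete form for a vertex group `H = ⟨S⟩ ≤ Γ_{g,r}` that is not a free factor).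
`T` = the twisted letters (whole handles; all cusps or none), `Φ : Γ_{g,r} → M` a character, `S ⊆` twisted
letters `∪` (untwisted words killed by `Φ`), every twisted letter in `⟨S⟩`, `N ⊴ Γ_{g,r}`, `f ∈ Γ_{g,r}`.  Then some
character `χ : N → M` has `χ(g h g⁻¹) = Φ h` for `h ∈ ⟨S⟩`, `g h g⁻¹ ∈ N`, `f⁻¹ g ∈ ⟨S⟩·N`, `χ(g h g⁻¹) = 1`
when `f⁻¹ g ∉ ⟨S⟩·N`, and `χ(g p g⁻¹) = 1` for untwisted words `p`. [cite: MochizukiCombGC2007, Prop 1.2 proof p.9] -/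
theorem exists_levelCharacter_vertexTwist (T : Set (puncturedSurfaceGen g r)) [DecidablePred (· ∈ T)]
    (hTab : ∀ i : Fin g, (Sum.inl (i, false) : puncturedSurfaceGen g r) ∈ T ↔
      (Sum.inl (i, true) : puncturedSurfaceGen g r) ∈ T)
    (hTc : (∀ j : Fin r, (Sum.inr j : puncturedSurfaceGen g r) ∈ T) ∨
      ∀ j : Fin r, (Sum.inr j : puncturedSurfaceGen g r) ∉ T)
    {M : Type*} [CommGroup M] (Φ : PuncturedSurfaceGroup g r →* M)
    (S : Set (PuncturedSurfaceGroup g r))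
    (hS : ∀ x ∈ S, (∃ s ∈ T, x = PresentedGroup.of s) ∨
      (x ∈ Subgroup.closure
          ((fun s => (PresentedGroup.of s : PuncturedSurfaceGroup g r)) '' Tᶜ) ∧ Φ x = 1))
    (hTS : ∀ s ∈ T, (PresentedGroup.of s : PuncturedSurfaceGroup g r) ∈ Subgroup.closure S)
    (N : Subgroup (PuncturedSurfaceGroup g r)) [hN : N.Normal] (f : PuncturedSurfaceGroup g r) :
    ∃ χ : N →* M,
      (∀ g' : PuncturedSurfaceGroup g r,
          f⁻¹ * g' ∈ (Subgroup.closure S : Set (PuncturedSurfaceGroup g r)) * (N : Set _) →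
        ∀ (x : PuncturedSurfaceGroup g r) (hx : x ∈ Subgroup.closure S ⊓ N),
          χ ⟨g' * x * g'⁻¹, hN.conj_mem x hx.2 g'⟩ = Φ x) ∧
      (∀ g' : PuncturedSurfaceGroup g r,
          f⁻¹ * g' ∉ (Subgroup.closure S : Set (PuncturedSurfaceGroup g r)) * (N : Set _) →
        ∀ (x : PuncturedSurfaceGroup g r) (hx : x ∈ Subgroup.closure S ⊓ N),
          χ ⟨g' * x * g'⁻¹, hN.conj_mem x hx.2 g'⟩ = 1) ∧
      ∀ (g' x : PuncturedSurfaceGroup g r)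
        (hx : x ∈ Subgroup.closure
          ((fun s => (PresentedGroup.of s : PuncturedSurfaceGroup g r)) '' Tᶜ) ⊓ N),
        χ ⟨g' * x * g'⁻¹, hN.conj_mem x hx.2 g'⟩ = 1 := by
  classical
  set H : Subgroup (PuncturedSurfaceGroup g r) := Subgroup.closure S with hHdef
  set Pl : Subgroup (PuncturedSurfaceGroup g r) := Subgroup.closure
    ((fun s => (PresentedGroup.of s : PuncturedSurfaceGroup g r)) '' Tᶜ) with hPldef
  -- the quotient `Γ/N`, the image `H̄` of the vertex group, the orbit `O` of `π(f⁻¹)`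
  set π : PuncturedSurfaceGroup g r →* PuncturedSurfaceGroup g r ⧸ N := QuotientGroup.mk' N with hπ
  have hπN : ∀ {x : PuncturedSurfaceGroup g r}, π x = 1 ↔ x ∈ N := fun {x} => by rw [hπ, QuotientGroup.mk'_apply, QuotientGroup.eq_one_iff]
  set Hbar : Subgroup (PuncturedSurfaceGroup g r ⧸ N) := H.map π with hHbar
  have hHN : ∀ {x : PuncturedSurfaceGroup g r}, π x ∈ Hbar ↔
      x ∈ (H : Set (PuncturedSurfaceGroup g r)) * (N : Set _) := fun {x} => by
    have hk : H ⊔ N = Hbar.comap π := by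
      rw [hHbar, Subgroup.comap_map_eq, hπ, QuotientGroup.ker_mk']
    rw [← Subgroup.mul_normal H N, SetLike.mem_coe, hk, Subgroup.mem_comap]
  let O : Set (PuncturedSurfaceGroup g r ⧸ N) := {q | q * π f ∈ Hbar}
  have hO_mul : ∀ {a'}, a' ∈ H → ∀ q, π a' * q ∈ O ↔ q ∈ O := fun {a'} ha' q => by
    change π a' * q * π f ∈ Hbar ↔ q * π f ∈ Hbar
    rw [mul_assoc]
    exact Subgroup.mul_mem_cancel_left _ (Subgroup.mem_map_of_mem π ha')
  -- the indicator cocycle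
  let cc : PuncturedSurfaceGroup g r → PuncturedSurfaceGroup g r ⧸ N → M := fun a' q =>
    if q ∈ O then Φ a' else 1
  have hcc_pos : ∀ {a' q}, q ∈ O → cc a' q = Φ a' := fun {a' q} hq => if_pos hq
  have hcc_neg : ∀ {a' q}, q ∉ O → cc a' q = 1 := fun {a' q} hq => if_neg hq
  have hcc_one : ∀ {a'} q, Φ a' = 1 → cc a' q = 1 := fun {a'} q h1 => by
    by_cases hq : q ∈ O <;> simp only [hcc_pos, hcc_neg, hq, h1, not_false_eq_true]
  have hcc_mul : ∀ (a₁) {a₂}, a₂ ∈ H → ∀ q, cc (a₁ * a₂) q = cc a₁ (π a₂ * q) * cc a₂ q := by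
    intro a₁ a₂ ha₂ q
    by_cases hq : q ∈ O
    · rw [hcc_pos hq, hcc_pos ((hO_mul ha₂ q).mpr hq), hcc_pos hq, map_mul]
    · rw [hcc_neg hq, hcc_neg (fun h => hq ((hO_mul ha₂ q).mp h)), hcc_neg hq, mul_one]
  -- the twisted translation
  let Tw : PuncturedSurfaceGroup g r → (PuncturedSurfaceGroup g r ⧸ N) × M → (PuncturedSurfaceGroup g r ⧸ N) × M :=
    fun a' x => (π a' * x.1, x.2 * cc a' x.1)
  have hTw : ∀ a' q m₀, Tw a' (q, m₀) = (π a' * q, m₀ * cc a' q) := fun _ _ _ => rfl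
  have hTw_mul : ∀ (a₁) {a₂}, a₂ ∈ H → ∀ x, Tw (a₁ * a₂) x = Tw a₁ (Tw a₂ x) := by
    rintro a₁ a₂ ha₂ ⟨q, m₀⟩
    change (π (a₁ * a₂) * q, m₀ * cc (a₁ * a₂) q) = (π a₁ * (π a₂ * q), m₀ * cc a₂ q * cc a₁ (π a₂ * q))
    rw [map_mul, mul_assoc (π a₁) (π a₂) q, hcc_mul a₁ ha₂, mul_assoc m₀,
      mul_comm (cc a₁ (π a₂ * q)) (cc a₂ q)]
  have hTw_one : ∀ x, Tw 1 x = x := fun x => by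
    rw [← Prod.mk.eta (p := x), hTw, map_one, one_mul, hcc_one _ (map_one Φ), mul_one]
  let perm : ∀ a' : PuncturedSurfaceGroup g r, a' ∈ H → Equiv.Perm ((PuncturedSurfaceGroup g r ⧸ N) × M) := fun a' ha' =>
    { toFun := Tw a'
      invFun := Tw a'⁻¹
      left_inv := fun x => by rw [← hTw_mul a'⁻¹ ha', inv_mul_cancel, hTw_one]
      right_inv := fun x => by rw [← hTw_mul a' (H.inv_mem ha'), mul_inv_cancel, hTw_one] }
  have hperm : ∀ {a'} (ha' : a' ∈ H) x, perm a' ha' x = Tw a' x := fun _ _ => rfl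
  let ρH : H →* Equiv.Perm ((PuncturedSurfaceGroup g r ⧸ N) × M) :=
    { toFun := fun a' => perm a' a'.2
      map_one' := Equiv.ext fun x => by
        change Tw ((1 : H) : PuncturedSurfaceGroup g r) x = x
        rw [OneMemClass.coe_one, hTw_one]
      map_mul' := fun a₁ a₂ => Equiv.ext fun x => by
        change Tw ((a₁ * a₂ : H) : PuncturedSurfaceGroup g r) x = Tw (a₁ : PuncturedSurfaceGroup g r) (Tw (a₂ : PuncturedSurfaceGroup g r) x)
        rw [Subgroup.coe_mul, hTw_mul _ a₂.2] }
  have hρH : ∀ (a' : H) x, ρH a' x = Tw a' x := fun _ _ => rfl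
  -- the plain translation
  let plainHom : PuncturedSurfaceGroup g r →* Equiv.Perm ((PuncturedSurfaceGroup g r ⧸ N) × M) :=
    { toFun := fun y => (Equiv.mulLeft (π y)).prodCongr (Equiv.refl M)
      map_one' := Equiv.ext fun x => by
        change (π 1 * x.1, x.2) = x
        rw [map_one, one_mul]
      map_mul' := fun y y' => Equiv.ext fun x => by
        change (π (y * y') * x.1, x.2) = (π y * (π y' * x.1), x.2)
        rw [map_mul, mul_assoc] }
  have hplainHom : ∀ y q m₀, plainHom y (q, m₀) = (π y * q, m₀) := fun _ _ _ => rfl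
  have hperm_plain : ∀ {a'} (ha' : a' ∈ H), Φ a' = 1 → perm a' ha' = plainHom a' :=
    fun {a'} ha' h1 => Equiv.ext fun x => by rw [hperm ha', hTw, hplainHom, hcc_one x.1 h1, mul_one]
  -- the generators
  let σ : puncturedSurfaceGen g r → Equiv.Perm ((PuncturedSurfaceGroup g r ⧸ N) × M) := fun s =>
    if hs : s ∈ T then ρH ⟨PresentedGroup.of s, hTS s hs⟩ else plainHom (PresentedGroup.of s)
  have hσT : ∀ {s} (hs : s ∈ T), σ s = ρH ⟨PresentedGroup.of s, hTS s hs⟩ := fun {s} hs => dif_pos hs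
  have hσP : ∀ {s}, s ∉ T → σ s = plainHom (PresentedGroup.of s) := fun {s} hs => dif_neg hs
  -- each commutator block acts plainly
  have hcomm : ∀ i : Fin g,
      σ (Sum.inl (i, false)) * σ (Sum.inl (i, true)) * (σ (Sum.inl (i, false)))⁻¹ *
          (σ (Sum.inl (i, true)))⁻¹ =
        plainHom (a (r := r) i * b i * (a i)⁻¹ * (b i)⁻¹) := by
    intro i
    by_cases hi : (Sum.inl (i, false) : puncturedSurfaceGen g r) ∈ T
    · have hi' : (Sum.inl (i, true) : puncturedSurfaceGen g r) ∈ T := (hTab i).mp hi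
      rw [hσT hi, hσT hi', ← map_inv, ← map_inv, ← map_mul, ← map_mul, ← map_mul]
      have hmem : a (r := r) i * b i * (a i)⁻¹ * (b i)⁻¹ ∈ H :=
        H.mul_mem (H.mul_mem (H.mul_mem (hTS _ hi) (hTS _ hi')) (H.inv_mem (hTS _ hi)))
          (H.inv_mem (hTS _ hi'))
      exact hperm_plain hmem (map_comm_eq_one Φ _ _)
    · have hi' : (Sum.inl (i, true) : puncturedSurfaceGen g r) ∉ T := fun h => hi ((hTab i).mpr h)
      rw [hσP hi, hσP hi', ← map_inv, ← map_inv, ← map_mul, ← map_mul, ← map_mul]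
      rfl
  have hcH : ∀ (hall : ∀ j : Fin r, (Sum.inr j : puncturedSurfaceGen g r) ∈ T) (j : Fin r),
      (c (g := g) j : PuncturedSurfaceGroup g r) ∈ H := fun hall j => hTS _ (hall j)
  -- the relator acts trivially
  have hrel : ∀ w ∈ ({relator g r} : Set (FreeGroup (puncturedSurfaceGen g r))),
      FreeGroup.lift σ w = 1 := by
    intro w hw
    rw [Set.mem_singleton_iff] at hw
    rw [hw, lift_relator]
    have h1 : ((List.finRange g).map fun i =>
        σ (Sum.inl (i, false)) * σ (Sum.inl (i, true)) * (σ (Sum.inl (i, false)))⁻¹ *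
          (σ (Sum.inl (i, true)))⁻¹).prod =
        plainHom ((List.finRange g).map fun i : Fin g => a (r := r) i * b i * (a i)⁻¹ * (b i)⁻¹).prod := by
      rw [map_list_prod, List.map_map]
      exact congrArg (fun F : Fin g → Equiv.Perm ((PuncturedSurfaceGroup g r ⧸ N) × M) =>
        ((List.finRange g).map F).prod) (funext hcomm)
    rw [h1]
    rcases hTc with hall | hnone
    · -- all cusps twisted: the cusp block is `ρH (∏ c_j)`, killed by `Φ(∏ c_j) = 1` and the relator
      let y : H := ((List.finRange r).map fun j : Fin r => (⟨c j, hcH hall j⟩ : H)).prod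
      have hy : (y : PuncturedSurfaceGroup g r) = ((List.finRange r).map fun j : Fin r => c (g := g) j).prod := by
        change ((((List.finRange r).map fun j : Fin r => (⟨c j, hcH hall j⟩ : H)).prod : H) : PuncturedSurfaceGroup g r) = _
        rw [Subgroup.val_list_prod, List.map_map]; rfl
      have h2 : ((List.finRange r).map fun j => σ (Sum.inr j)).prod = ρH y := by
        rw [map_list_prod, List.map_map]
        exact congrArg (fun F : Fin r → Equiv.Perm ((PuncturedSurfaceGroup g r ⧸ N) × M) =>
          ((List.finRange r).map F).prod) (funext fun j => hσT (hall j))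
      rw [h2]
      refine Equiv.ext fun x => ?_
      obtain ⟨q, m₀⟩ := x
      rw [Equiv.Perm.mul_apply, hρH, hTw, hplainHom, Equiv.Perm.one_apply, ← mul_assoc, ← map_mul, hy,
        comm_prod_mul_cusp_prod_eq_one, map_one, one_mul, hcc_one q (map_cusp_prod_eq_one Φ), mul_one]
    · have h2 : ((List.finRange r).map fun j => σ (Sum.inr j)).prod =
          plainHom ((List.finRange r).map fun j : Fin r => c (g := g) j).prod := by
        rw [map_list_prod, List.map_map]
        exact congrArg (fun F : Fin r → Equiv.Perm ((PuncturedSurfaceGroup g r ⧸ N) × M) =>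
          ((List.finRange r).map F).prod) (funext fun j => hσP (hnone j))
      rw [h2, ← map_mul, comm_prod_mul_cusp_prod_eq_one, map_one]
  -- the action of `Γ`
  let ρ : PuncturedSurfaceGroup g r →* Equiv.Perm ((PuncturedSurfaceGroup g r ⧸ N) × M) :=
    PresentedGroup.toGroup hrel
  have hρ_of : ∀ s, ρ (PresentedGroup.of s) = σ s := fun s => PresentedGroup.toGroup.of hrel
  have hρ_plain : ∀ {p}, p ∈ Pl → ρ p = plainHom p := fun {p} hp => by
    refine (Subgroup.closure_le (K := ρ.eqLocus plainHom)).mpr ?_ hp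
    rintro _ ⟨s, hs, rfl⟩
    change ρ (PresentedGroup.of s) = plainHom (PresentedGroup.of s)
    rw [hρ_of, hσP hs]
  have hρ_H : ∀ a' (ha' : a' ∈ H) x, ρ a' x = Tw a' x := by
    intro a' ha'
    refine Subgroup.closure_induction (p := fun a' _ => ∀ x, ρ a' x = Tw a' x) ?_ ?_ ?_ ?_ ha'
    · intro x hx y
      rcases hS x hx with ⟨s, hs, rfl⟩ | ⟨hxP, hΦx⟩
      · rw [hρ_of, hσT hs, hρH]
      · rw [hρ_plain hxP, ← Prod.mk.eta (p := y), hplainHom, hTw, hcc_one _ hΦx, mul_one]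
    · intro y; rw [map_one, Equiv.Perm.one_apply, hTw_one]
    · intro x y hx hy ihx ihy z
      rw [map_mul, Equiv.Perm.mul_apply, ihy, ihx, hTw_mul x hy]
    · intro x hx ih z
      have h1 : ρ x (Tw x⁻¹ z) = z := by
        rw [ih, ← hTw_mul x (H.inv_mem hx), mul_inv_cancel, hTw_one]
      calc ρ x⁻¹ z = ρ x⁻¹ (ρ x (Tw x⁻¹ z)) := by rw [h1]
        _ = Tw x⁻¹ z := by
          rw [← Equiv.Perm.mul_apply, ← map_mul, inv_mul_cancel, map_one, Equiv.Perm.one_apply]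
  -- `ρ γ` is fibred over left translation: `ρ γ (q, m) = (γ·q, m·κ(q))` for some `κ : Γ/N → M`
  have hfib : ∀ γ : PuncturedSurfaceGroup g r, ∃ κ : PuncturedSurfaceGroup g r ⧸ N → M, ∀ q m₀, ρ γ (q, m₀) = (π γ * q, m₀ * κ q) := by
    have hTw' : ∀ a', ∃ κ : PuncturedSurfaceGroup g r ⧸ N → M, ∀ q m₀, Tw a' (q, m₀) = (π a' * q, m₀ * κ q) :=
      fun a' => ⟨cc a', fun q m₀ => rfl⟩
    have hpl : ∀ y, ∃ κ : PuncturedSurfaceGroup g r ⧸ N → M, ∀ q m₀, plainHom y (q, m₀) = (π y * q, m₀ * κ q) :=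
      fun y => ⟨fun _ => 1, fun q m₀ => by rw [hplainHom, mul_one]⟩
    have hgen : ∀ s, (∃ κ : PuncturedSurfaceGroup g r ⧸ N → M,
        ∀ q m₀, σ s (q, m₀) = (π (PresentedGroup.of s) * q, m₀ * κ q)) ∧
        ∃ κ : PuncturedSurfaceGroup g r ⧸ N → M,
          ∀ q m₀, (σ s)⁻¹ (q, m₀) = (π (PresentedGroup.of s)⁻¹ * q, m₀ * κ q) := by
      intro s
      by_cases hs : s ∈ T
      · rw [hσT hs, ← map_inv]
        exact ⟨hTw' _, hTw' _⟩
      · rw [hσP hs, ← map_inv]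
        exact ⟨hpl _, hpl _⟩
    intro γ
    induction γ using PresentedGroup.induction_on with
    | H z =>
      induction z using FreeGroup.induction_on with
      | C1 =>
        exact ⟨fun _ => 1, fun q m₀ => by
          rw [map_one, map_one, Equiv.Perm.one_apply, map_one, one_mul, mul_one]⟩
      | of s =>
        change ∃ κ : PuncturedSurfaceGroup g r ⧸ N → M,
          ∀ q m₀, ρ (PresentedGroup.of s) (q, m₀) = (π (PresentedGroup.of s) * q, m₀ * κ q)
        rw [hρ_of]
        exact (hgen s).1
      | inv_of s _ =>
        change ∃ κ : PuncturedSurfaceGroup g r ⧸ N → M,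
          ∀ q m₀, ρ (PresentedGroup.of s)⁻¹ (q, m₀) = (π (PresentedGroup.of s)⁻¹ * q, m₀ * κ q)
        rw [map_inv, hρ_of]
        exact (hgen s).2
      | mul x y ihx ihy =>
        obtain ⟨κ₁, h₁⟩ := ihx
        obtain ⟨κ₂, h₂⟩ := ihy
        refine ⟨fun q => κ₂ q * κ₁ (π (PresentedGroup.mk _ y) * q), fun q m₀ => ?_⟩
        rw [map_mul, map_mul ρ, Equiv.Perm.mul_apply, h₂, h₁, map_mul π]
        exact Prod.ext (mul_assoc _ _ _).symm (mul_assoc _ _ _)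
  have hρ_fst : ∀ (γ : PuncturedSurfaceGroup g r) q (m₀ : M), (ρ γ (q, m₀)).1 = π γ * q := fun γ q m₀ => by
    obtain ⟨κ, h⟩ := hfib γ
    rw [h]
  have hρ_snd : ∀ (γ : PuncturedSurfaceGroup g r) q (m₀ m : M), ρ γ (q, m₀ * m) = ((ρ γ (q, m₀)).1, (ρ γ (q, m₀)).2 * m) :=
      fun γ q m₀ m => by
    obtain ⟨κ, h⟩ := hfib γ
    rw [h, h, mul_right_comm]
  -- the character `χ(n) = pr₂ (ρ n (1, 1))`
  set x₁ : (PuncturedSurfaceGroup g r ⧸ N) × M := (1, 1) with hx₁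
  have hρN : ∀ {n : PuncturedSurfaceGroup g r}, n ∈ N → ρ n x₁ = (1, (ρ n x₁).2) := fun {n} hn =>
    Prod.ext (by rw [hx₁, hρ_fst, hπN.mpr hn, one_mul]) rfl
  let χ : N →* M :=
    { toFun := fun n => (ρ (n : PuncturedSurfaceGroup g r) x₁).2
      map_one' := by
        change (ρ ((1 : N) : PuncturedSurfaceGroup g r) x₁).2 = 1
        rw [OneMemClass.coe_one, map_one, Equiv.Perm.one_apply]
      map_mul' := fun n n' => by
        change (ρ ((n : PuncturedSurfaceGroup g r) * n') x₁).2 =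
          (ρ (n : PuncturedSurfaceGroup g r) x₁).2 * (ρ (n' : PuncturedSurfaceGroup g r) x₁).2
        have h := hρ_snd (n : PuncturedSurfaceGroup g r) 1 1 (ρ (n' : PuncturedSurfaceGroup g r) x₁).2
        rw [one_mul, ← hx₁] at h
        rw [map_mul ρ, Equiv.Perm.mul_apply, hρN n'.2, h] }
  have hχ : ∀ (n : PuncturedSurfaceGroup g r) (hn : n ∈ N), χ ⟨n, hn⟩ = (ρ n x₁).2 := fun _ _ => rfl
  -- evaluation on level conjugates of elements acting fibrewise by a KNOWN function `κ`
  have heval : ∀ (g' x : PuncturedSurfaceGroup g r) (hxN : x ∈ N) (κ : PuncturedSurfaceGroup g r ⧸ N → M)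
      (hx : ∀ q m₀, ρ x (q, m₀) = (π x * q, m₀ * κ q)),
      χ ⟨g' * x * g'⁻¹, hN.conj_mem x hxN g'⟩ = κ (π g'⁻¹) := by
    intro g' x hxN κ hx
    rw [hχ, map_mul ρ, map_mul ρ, Equiv.Perm.mul_apply, Equiv.Perm.mul_apply]
    set y := ρ g'⁻¹ x₁ with hy
    have hy1 : y.1 = π g'⁻¹ := by
      have h := hρ_fst g'⁻¹ 1 1
      rw [← hx₁, ← hy, mul_one] at h
      exact h
    have hxy : ρ x y = (y.1, y.2 * κ (π g'⁻¹)) := by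
      rw [← Prod.mk.eta (p := y), hx, hπN.mpr hxN, one_mul, hy1]
    rw [hxy, hρ_snd g' y.1 y.2, Prod.mk.eta, hy, ← Equiv.Perm.mul_apply, ← map_mul, mul_inv_cancel,
      map_one, Equiv.Perm.one_apply]
    exact one_mul _
  have hinv_mem : ∀ {x : PuncturedSurfaceGroup g r}, x ∈ (H : Set (PuncturedSurfaceGroup g r)) * (N : Set _) →
      x⁻¹ ∈ (H : Set (PuncturedSurfaceGroup g r)) * (N : Set _) := fun {x} hx => by
    rw [← Subgroup.mul_normal H N, SetLike.mem_coe] at hx ⊢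
    exact (H ⊔ N).inv_mem hx
  refine ⟨χ, fun g' hg' x hx => ?_, fun g' hg' x hx => ?_, fun g' x hx => ?_⟩
  · rw [heval g' x hx.2 (cc x) (fun q m₀ => hρ_H x hx.1 (q, m₀))]
    refine hcc_pos (hHN.mpr ?_)
    simpa only [mul_inv_rev, inv_inv] using hinv_mem hg'
  · rw [heval g' x hx.2 (cc x) (fun q m₀ => hρ_H x hx.1 (q, m₀))]
    refine hcc_neg fun hgO => hg' ?_
    have h1 : g'⁻¹ * f ∈ (H : Set (PuncturedSurfaceGroup g r)) * (N : Set _) := hHN.mp (by rwa [map_mul])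
    simpa only [mul_inv_rev, inv_inv] using hinv_mem h1
  · rw [heval g' x hx.2 (fun _ => 1) (fun q m₀ => by rw [hρ_plain hx.1, hplainHom, mul_one])]

/-- **Separating level for a non-free-factor vertex group** ([CombGC] Prop. 1.2 proof p. 9, verticial case,
discrete form): in the setting of `exists_levelCharacter_vertexTwist` with `M` finite and `Φ x₀ ≠ 1` for some
`x₀ ∈ ⟨S⟩ ∩ N`, some `U ⊴ N` with `[N : U] ∣ |M|` misses `f x₀ f⁻¹`, contains `(g ⟨S⟩ g⁻¹) ∩ N` whenever
`f⁻¹ g ∉ ⟨S⟩·N` (every OTHER level vertex over the vertex) and every `(g Pl g⁻¹) ∩ N`, `Pl` the untwisted subgroup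
(level vertices of the other components, level edges at the node branches).  Output shape of the discrete
suppliers of `IsProSigmaCompletion.exists_open_unrSeparating_same`. [cite: MochizukiCombGC2007, Prop 1.2 proof p.9] -/
theorem exists_normal_separating_vertexTwist (T : Set (puncturedSurfaceGen g r)) [DecidablePred (· ∈ T)]
    (hTab : ∀ i : Fin g, (Sum.inl (i, false) : puncturedSurfaceGen g r) ∈ T ↔
      (Sum.inl (i, true) : puncturedSurfaceGen g r) ∈ T)
    (hTc : (∀ j : Fin r, (Sum.inr j : puncturedSurfaceGen g r) ∈ T) ∨
      ∀ j : Fin r, (Sum.inr j : puncturedSurfaceGen g r) ∉ T)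
    {M : Type*} [CommGroup M] [Finite M] (Φ : PuncturedSurfaceGroup g r →* M)
    (S : Set (PuncturedSurfaceGroup g r))
    (hS : ∀ x ∈ S, (∃ s ∈ T, x = PresentedGroup.of s) ∨
      (x ∈ Subgroup.closure
          ((fun s => (PresentedGroup.of s : PuncturedSurfaceGroup g r)) '' Tᶜ) ∧ Φ x = 1))
    (hTS : ∀ s ∈ T, (PresentedGroup.of s : PuncturedSurfaceGroup g r) ∈ Subgroup.closure S)
    (N : Subgroup (PuncturedSurfaceGroup g r)) [hN : N.Normal] (f : PuncturedSurfaceGroup g r)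
    (x₀ : PuncturedSurfaceGroup g r) (hx₀ : x₀ ∈ Subgroup.closure S ⊓ N) (hΦ : Φ x₀ ≠ 1) :
    ∃ U : Subgroup N, U.Normal ∧ U.index ∣ Nat.card M ∧ U.FiniteIndex ∧
      f * x₀ * f⁻¹ ∉ U.map N.subtype ∧
      (∀ g' : PuncturedSurfaceGroup g r,
          f⁻¹ * g' ∉ (Subgroup.closure S : Set (PuncturedSurfaceGroup g r)) * (N : Set _) →
        (ConjAct.toConjAct g' • Subgroup.closure S) ⊓ N ≤ U.map N.subtype) ∧
      ∀ g' : PuncturedSurfaceGroup g r,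
        (ConjAct.toConjAct g' • Subgroup.closure
          ((fun s => (PresentedGroup.of s : PuncturedSurfaceGroup g r)) '' Tᶜ)) ⊓ N ≤ U.map N.subtype := by
  classical
  obtain ⟨χ, hχf, hχg, hχp⟩ := exists_levelCharacter_vertexTwist T hTab hTc Φ S hS hTS N f
  have hconj : ∀ (A : Subgroup (PuncturedSurfaceGroup g r)) (g' z : PuncturedSurfaceGroup g r),
      z ∈ (ConjAct.toConjAct g' • A) ⊓ N →
        ∃ (x : PuncturedSurfaceGroup g r) (hx : x ∈ A ⊓ N), z = g' * x * g'⁻¹ := by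
    intro A g' z hz
    obtain ⟨hz1, hz2⟩ := Subgroup.mem_inf.mp hz
    obtain ⟨x, hxA, rfl⟩ := (Subgroup.mem_smul_pointwise_iff_exists _ _ _).mp hz1
    rw [ConjAct.smul_def, ConjAct.ofConjAct_toConjAct] at hz2 ⊢
    exact ⟨x, Subgroup.mem_inf.mpr ⟨hxA, by simpa [mul_assoc] using hN.conj_mem _ hz2 g'⁻¹⟩, rfl⟩
  refine ⟨χ.ker, inferInstance, ?_, ?_, ?_, ?_, ?_⟩
  · rw [Subgroup.index_ker]
    exact Subgroup.card_subgroup_dvd_card χ.range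
  · exact ⟨fun h0 => (Nat.card_pos (α := χ.range)).ne' (by rwa [Subgroup.index_ker] at h0)⟩
  · intro hmem
    obtain ⟨u, hu, hu'⟩ := Subgroup.mem_map.mp hmem
    have hf : f⁻¹ * f ∈ (Subgroup.closure S : Set (PuncturedSurfaceGroup g r)) * (N : Set _) := by
      rw [inv_mul_cancel]
      exact Set.mem_mul.mpr ⟨1, Subgroup.one_mem _, 1, Subgroup.one_mem _, mul_one 1⟩
    refine hΦ ?_
    rw [← hχf f hf x₀ hx₀, ← show u = ⟨f * x₀ * f⁻¹, hN.conj_mem _ hx₀.2 f⟩ from Subtype.ext hu']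
    exact hu
  · intro g' hg' z hz
    obtain ⟨x, hx, rfl⟩ := hconj _ g' z hz
    exact Subgroup.mem_map.mpr ⟨⟨g' * x * g'⁻¹, hN.conj_mem x hx.2 g'⟩, hχg g' hg' x hx, rfl⟩
  · intro g' z hz
    obtain ⟨x, hx, rfl⟩ := hconj _ g' z hz
    exact Subgroup.mem_map.mpr ⟨⟨g' * x * g'⁻¹, hN.conj_mem x hx.2 g'⟩, hχp g' x hx, rfl⟩

end PuncturedSurfaceGroup

end Literature.GroupTheory.CombinatorialGroupTheory
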